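import Mathlib.Algebra.BigOperators.Fin
import Mathlib.Tactic.FinCases
import Mathlib.Tactic.LinearCombination
import Literature.Computability.Cryptography.QuantumCircuitProofs
import Literature.Computability.QuantumComplexity.GaussianRank

/-!
# Crux `SpinorFlattening.NegApproxGaussRankSuperpoly` (stmt-QuantumAdvantage-1245) — stub `stub_flatOrthoOfInvariant`

Line `spectral-mass-flattening`, stub `stub_flatOrthoOfInvariant` (ORTHONORMALITY OF THE FLAT FAMILY FROM
TWO SYMMETRIES, pure Pauli algebra).  On `t * 4` qubits let `mono s` be the block monomial of a pattern
`s : Fin t → Option (Fin 4 × Bool)` — the ordered product over the excited blocks `b` of the Jordan–Wigner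
Majoranas `c_{(b,i),β} = majorana (t*4) (finProdFinEquiv (b,i)) β` — and let `ψ` be a unit vector fixed by
every block string `X_{4b} X_{4b+1} X_{4b+2} X_{4b+3}` and by every in-block pair `Z_{4b+i₁} Z_{4b+i₂}`
(`i₁ ≠ i₂`).  Then the vectors `mono s ψ` are orthonormal.

Proof.
* Norms: every `mono s` is a product of Pauli strings, hence unitary.
* Sign lemma: for Pauli strings `σ_P σ_S σ_P = (∏_w sign (P w) (S w)) • σ_S` (letterwise conjugation
  table), hence `σ_P (∏ σ_{S_k}) σ_P = (∏_k ε_k) • ∏ σ_{S_k}` for a list of strings (insert `σ_P σ_P = 1`).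
* Per-factor signs against `c_{(b,i),β}` (word `Z` below wire `4b+i`, `X`/`Y` at it, `I` above):
  the block string `X⊗4` on `b₀` gives `1` if `b ≠ b₀` (four `I`'s or four `Z`'s) and `(-1)^(i + [β])`
  if `b = b₀`; the pair `Z_{(b₀,i₁)} Z_{(b₀,i₂)}` gives `-1` iff `(b,i) ∈ {(b₀,i₁),(b₀,i₂)}`.  So
  `σ_P (mono s) σ_P = ε_s • mono s` with `ε_s` read off from `s b₀` alone.
* Symmetry ⇒ vanishing: if `σ_P ψ = ψ`, `σ_P A σ_P = ε_A A`, `σ_P B σ_P = ε_B B` and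
  `conj(ε_A) ε_B = -1`, then `⟨Aψ, Bψ⟩ = ⟨σ_P A ψ, σ_P B ψ⟩ = conj(ε_A) ε_B ⟨Aψ, Bψ⟩ = -⟨Aψ, Bψ⟩ = 0`.
* For `s ≠ s'` pick `b₀` with `s b₀ ≠ s' b₀`: same wire with `X` vs `Y` ⇒ use `X⊗4` on `b₀`
  (`ε_s ε_{s'} = (-1)^{2i+1}`); otherwise a pair `Z Z` in `b₀` meeting exactly one of the (at most two)
  excited wires of `b₀` (`ε_s = -1`, `ε_{s'} = 1` up to order).
-/

set_option linter.dupNamespace false -- D-0017: single-problem summit ⇒ `QuantumAdvantage.QuantumAdvantage` by design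

noncomputable section

namespace Summit.QuantumAdvantage.QuantumAdvantage.Theorems.SpinorFlattening

open Matrix Finset
open Literature.Computability.QuantumComplexity Literature.Computability.Cryptography

/-! ### Pauli-string conjugation signs -/

/-- Letterwise conjugation of Pauli strings: `σ_P σ_S σ_P = (∏_w sign (P w) (S w)) • σ_S`. -/
theorem flatOrtho_conj_pauliString {ι : Type*} [Fintype ι] [DecidableEq ι] (P S : ι → Pauli) :
    pauliString P * pauliString S * pauliString P =
      (∏ w, Pauli.sign (P w) (S w)) • pauliString S := by
  rw [pauliString_eq, pauliString_eq, tensorAll_mul, tensorAll_mul]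
  have key : (fun i => (P i).mat * (S i).mat * (P i).mat) =
      fun i => Pauli.sign (P i) (S i) • (S i).mat :=
    funext fun i => Pauli.mat_mul_mat_mul_mat _ _
  rw [key, tensorAll_smul_each]

/-- Conjugating a product of Pauli strings by a Pauli string multiplies it by the product of the
letterwise signs of the factors (insert `σ_P σ_P = 1` between consecutive factors). -/
theorem flatOrtho_conj_listProd {ι : Type*} [Fintype ι] [DecidableEq ι] (P : ι → Pauli)
    (L : List (ι → Pauli)) :
    pauliString P * (L.map pauliString).prod * pauliString P =
      (L.map fun S => ∏ w, Pauli.sign (P w) (S w)).prod • (L.map pauliString).prod := by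
  induction L with
  | nil =>
    rw [List.map_nil, List.map_nil, List.prod_nil, List.prod_nil, Matrix.mul_one,
      pauliString_mul_self, one_smul]
  | cons S L ih =>
    rw [List.map_cons, List.map_cons, List.prod_cons, List.prod_cons]
    calc pauliString P * (pauliString S * (L.map pauliString).prod) * pauliString P
        = (pauliString P * pauliString S * pauliString P) *
            (pauliString P * (L.map pauliString).prod * pauliString P) := by
          symm
          calc (pauliString P * pauliString S * pauliString P) *
                (pauliString P * (L.map pauliString).prod * pauliString P)
              = pauliString P * pauliString S * (pauliString P * pauliString P) *
                  ((L.map pauliString).prod * pauliString P) := by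
                simp only [Matrix.mul_assoc]
            _ = pauliString P * (pauliString S * (L.map pauliString).prod) * pauliString P := by
                rw [pauliString_mul_self, Matrix.mul_one]
                simp only [Matrix.mul_assoc]
      _ = _ := by
          rw [flatOrtho_conj_pauliString, ih, Matrix.smul_mul, Matrix.mul_smul, smul_smul]

/-- Pauli strings are unitary. -/
theorem flatOrtho_pauliString_mem_unitaryGroup {ι : Type*} [Fintype ι] [DecidableEq ι]
    (S : ι → Pauli) : pauliString S ∈ Matrix.unitaryGroup (ι → Bool) ℂ := by
  rw [Matrix.mem_unitaryGroup_iff, Matrix.star_eq_conjTranspose, conjTranspose_pauliString,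
    pauliString_mul_self]

/-! ### Inner products -/

/-- A unitary preserves the Hermitian form: `⟨U u, U v⟩ = ⟨u, v⟩`. -/
theorem flatOrtho_dot_mulVec_unitary {n : ℕ} {U : Matrix (QReg n) (QReg n) ℂ}
    (hU : U ∈ Matrix.unitaryGroup (QReg n) ℂ) (u v : QReg n → ℂ) :
    star (U *ᵥ u) ⬝ᵥ (U *ᵥ v) = star u ⬝ᵥ v := by
  rw [Matrix.star_mulVec, ← Matrix.dotProduct_mulVec, Matrix.mulVec_mulVec,
    ← Matrix.star_eq_conjTranspose, Matrix.mem_unitaryGroup_iff'.1 hU, Matrix.one_mulVec]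

/-- SYMMETRY ⇒ VANISHING: if the unitary `P` fixes `ψ`, `P A P = ε_A A`, `P B P = ε_B B` and
`conj(ε_A) ε_B = -1`, then `P (A ψ) = P A P ψ = ε_A (A ψ)`, likewise for `B`, so
`⟨A ψ, B ψ⟩ = ⟨P A ψ, P B ψ⟩ = conj(ε_A) ε_B ⟨A ψ, B ψ⟩ = -⟨A ψ, B ψ⟩` vanishes. -/
theorem flatOrtho_inner_eq_zero {n : ℕ} {P A B : Matrix (QReg n) (QReg n) ℂ} {ψ : QReg n → ℂ}
    {εA εB : ℂ} (hPu : P ∈ Matrix.unitaryGroup (QReg n) ℂ) (hψ : P *ᵥ ψ = ψ)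
    (hA : P * A * P = εA • A) (hB : P * B * P = εB • B) (hε : star εA * εB = -1) :
    star (A *ᵥ ψ) ⬝ᵥ (B *ᵥ ψ) = 0 := by
  have key : ∀ {C : Matrix (QReg n) (QReg n) ℂ} {ε : ℂ}, P * C * P = ε • C →
      P *ᵥ (C *ᵥ ψ) = ε • (C *ᵥ ψ) := fun {C ε} hC => by
    conv_lhs => rw [← hψ, Matrix.mulVec_mulVec, Matrix.mulVec_mulVec, hC, Matrix.smul_mulVec]
  have h : star (A *ᵥ ψ) ⬝ᵥ (B *ᵥ ψ) = -(star (A *ᵥ ψ) ⬝ᵥ (B *ᵥ ψ)) := by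
    conv_lhs => rw [← flatOrtho_dot_mulVec_unitary hPu (A *ᵥ ψ) (B *ᵥ ψ), key hA, key hB,
      star_smul, smul_dotProduct, dotProduct_smul, smul_smul, smul_eq_mul, hε]
    rw [neg_one_mul]
  linear_combination (1 / 2 : ℂ) * h

/-! ### Block arithmetic on `Fin (t * 4)` and the two sign tables -/

/-- Order of the wires `(b, i) ↦ 4b + i`: lexicographic in (block, position). -/
theorem flatOrtho_fPF_lt_iff {t : ℕ} (b b' : Fin t) (i i' : Fin 4) :
    (finProdFinEquiv (b, i) : Fin (t * 4)) < finProdFinEquiv (b', i') ↔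
      b < b' ∨ (b = b' ∧ i < i') := by
  have hi := i.isLt
  have hi' := i'.isLt
  simp only [Fin.lt_def, finProdFinEquiv_apply_val, Fin.ext_iff]
  omega

/-- Sign table of the block string `X_{4b₀} X_{4b₀+1} X_{4b₀+2} X_{4b₀+3}` against the Majorana word
`c_{(b,i),β}`: `1` off the block (`b < b₀`: four `I`'s; `b₀ < b`: four `Z`'s), and on the block
`(-1)^i` (the `Z`'s below the excited wire) times `(-1)^{[β]}` (`X` commutes with `X`, not with `Y`). -/
theorem flatOrtho_sign_X {t : ℕ} (b₀ b : Fin t) (i : Fin 4) (β : Bool) :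
    ∏ w, Pauli.sign (if (finProdFinEquiv.symm w).1 = b₀ then Pauli.X else Pauli.I)
        (majoranaWord (t * 4) (finProdFinEquiv (b, i)) β w) =
      if b = b₀ then (-1) ^ ((i : ℕ) + β.toNat) else 1 := by
  rw [← (finProdFinEquiv (m := t) (n := 4)).prod_comp, Fintype.prod_prod_type,
    Finset.prod_eq_single b₀]
  · simp only [Equiv.symm_apply_apply, if_true]
    by_cases hb : b = b₀
    · subst hb
      rw [if_pos rfl]
      have hw : ∀ i', majoranaWord (t * 4) (finProdFinEquiv (b, i)) β (finProdFinEquiv (b, i')) =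
          if i' < i then Pauli.Z else if i' = i then (if β then Pauli.Y else Pauli.X) else Pauli.I := by
        intro i'
        simp [majoranaWord, flatOrtho_fPF_lt_iff]
      simp only [hw, Fin.prod_univ_four]
      fin_cases i <;> cases β <;> simp [Pauli.sign] <;> norm_num
    · rw [if_neg hb]
      rcases lt_or_gt_of_ne hb with hlt | hgt
      · refine Finset.prod_eq_one fun i' _ => ?_
        rw [majoranaWord_of_gt (t * 4) β ((flatOrtho_fPF_lt_iff _ _ _ _).2 (Or.inl hlt))]
        simp [Pauli.sign]
      · have hw : ∀ i', majoranaWord (t * 4) (finProdFinEquiv (b, i)) β (finProdFinEquiv (b₀, i')) =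
            Pauli.Z :=
          fun i' => majoranaWord_of_lt (t * 4) β ((flatOrtho_fPF_lt_iff _ _ _ _).2 (Or.inl hgt))
        simp only [hw, Fin.prod_univ_four, Pauli.sign]
        simp
  · intro b' _ hb'
    simp only [Equiv.symm_apply_apply, if_neg hb']
    exact Finset.prod_eq_one fun _ _ => by simp [Pauli.sign]
  · exact fun h => absurd (Finset.mem_univ b₀) h

/-- Sign table of the in-block pair `Z_{(b₀,i₁)} Z_{(b₀,i₂)}` (`i₁ ≠ i₂`) against the Majorana word
`c_{(b,i),β}`: only the `X`/`Y` letter at wire `(b,i)` anticommutes with a `Z`, so the sign is `-1`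
iff `(b,i)` is one of the two wires. -/
theorem flatOrtho_sign_Z {t : ℕ} (b₀ : Fin t) {i₁ i₂ : Fin 4} (h12 : i₁ ≠ i₂) (b : Fin t) (i : Fin 4)
    (β : Bool) :
    ∏ w, Pauli.sign
        (if w = finProdFinEquiv (b₀, i₁) ∨ w = finProdFinEquiv (b₀, i₂) then Pauli.Z else Pauli.I)
        (majoranaWord (t * 4) (finProdFinEquiv (b, i)) β w) =
      if b = b₀ then (if i = i₁ ∨ i = i₂ then -1 else 1) else 1 := by
  have hne : (finProdFinEquiv (b₀, i₁) : Fin (t * 4)) ≠ finProdFinEquiv (b₀, i₂) := by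
    simpa using h12
  have key : ∀ w, Pauli.sign Pauli.Z (majoranaWord (t * 4) (finProdFinEquiv (b, i)) β w) =
      if finProdFinEquiv (b, i) = w then -1 else 1 := by
    intro w
    rcases lt_trichotomy w (finProdFinEquiv (b, i)) with hlt | heq | hgt
    · rw [majoranaWord_of_lt _ β hlt, if_neg hlt.ne']
      simp [Pauli.sign]
    · subst heq
      rw [majoranaWord_self, if_pos rfl]
      cases β <;> simp [Pauli.sign]
    · rw [majoranaWord_of_gt _ β hgt, if_neg hgt.ne]
      simp [Pauli.sign]
  rw [Finset.prod_eq_mul _ _ hne]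
  · simp only [true_or, or_true, if_true, key, EmbeddingLike.apply_eq_iff_eq, Prod.mk.injEq]
    by_cases hb : b = b₀
    · subst hb
      simp only [true_and, if_true]
      by_cases h1 : i = i₁
      · subst h1
        simp [h12]
      · by_cases h2 : i = i₂
        · subst h2
          simp [h1]
        · simp [h1, h2]
    · simp [hb]
  · intro w _ hw
    rw [if_neg (not_or.2 hw)]
    simp [Pauli.sign]
  · exact fun h => absurd (Finset.mem_univ _) h
  · exact fun h => absurd (Finset.mem_univ _) h

/-! ### Products over the excited blocks -/

/-- A `filterMap` product over the blocks is the product over all blocks with default `1`. -/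
theorem flatOrtho_prod_filterMap {t : ℕ} (g : Fin t → Option ℂ) :
    ((List.finRange t).filterMap g).prod = ∏ b, (g b).getD 1 := by
  have key : ∀ L : List (Fin t), (L.filterMap g).prod = (L.map fun b => (g b).getD 1).prod := by
    intro L
    induction L with
    | nil => rfl
    | cons b L ih =>
      cases hb : g b with
      | none => simp [hb, ih]
      | some x => simp [hb, ih]
  rw [key, ← Fin.prod_univ_def]

/-- The product of a scalar read off blockwise from the excited blocks. -/
theorem flatOrtho_prod_map_filterMap {t : ℕ} {α : Type*} (F : Fin t → Option α) (g : α → ℂ) :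
    (((List.finRange t).filterMap F).map g).prod = ∏ b, ((F b).map g).getD 1 := by
  rw [List.map_filterMap, flatOrtho_prod_filterMap]

/-! ### The stub -/

/-- **stub_flatOrthoOfInvariant** — ORTHONORMALITY OF THE FLAT FAMILY FROM TWO SYMMETRIES (pure Pauli
algebra): let `mono s` be the block monomial of the pattern `s` (hypothesis `hmono`) and let `ψ` be a unit
vector on `t * 4` qubits fixed by every block string `X_{4b}X_{4b+1}X_{4b+2}X_{4b+3}` and by every in-block
pair `Z_{4b+i₁} Z_{4b+i₂}` (`i₁ ≠ i₂`).  Then the vectors `mono s ψ` are orthonormal: norms by unitarity of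
the Majoranas; for `s ≠ s'` pick a block `b₀` with `s b₀ ≠ s' b₀` and one of the strings `P` above supported
on block `b₀` such that `P (mono s) P = ε mono s`, `P (mono s') P = ε' mono s'` with `conj(ε) ε' = -1`
(`X⊗4` on `b₀` when `s, s'` excite the same wire of `b₀` with `X` vs `Y`; a pair `Z_w Z_{w'}` in `b₀`
meeting exactly one of the excited wires otherwise), whence
`⟨mono s ψ, mono s' ψ⟩ = ⟨P mono s P ψ, P mono s' P ψ⟩ = −⟨mono s ψ, mono s' ψ⟩ = 0`. -/
theorem stub_flatOrthoOfInvariant :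
    ∀ (t : ℕ) (mono : (Fin t → Option (Fin 4 × Bool)) → Matrix (QReg (t * 4)) (QReg (t * 4)) ℂ),
      (∀ s, mono s = ((List.finRange t).filterMap fun b =>
          (s b).map fun q => majorana (t * 4) (finProdFinEquiv (b, q.1)) q.2).prod) →
      ∀ ψ : QReg (t * 4) → ℂ,
        (∀ b₀ : Fin t, pauliString (fun w : Fin (t * 4) =>
            if (finProdFinEquiv.symm w).1 = b₀ then Pauli.X else Pauli.I) *ᵥ ψ = ψ) →
        (∀ (b₀ : Fin t) (i₁ i₂ : Fin 4), i₁ ≠ i₂ → pauliString (fun w : Fin (t * 4) =>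
            if w = finProdFinEquiv (b₀, i₁) ∨ w = finProdFinEquiv (b₀, i₂) then Pauli.Z else Pauli.I) *ᵥ ψ = ψ) →
        star ψ ⬝ᵥ ψ = 1 →
        (∀ s, star (mono s *ᵥ ψ) ⬝ᵥ (mono s *ᵥ ψ) = 1) ∧
          ∀ s s', s ≠ s' → star (mono s *ᵥ ψ) ⬝ᵥ (mono s' *ᵥ ψ) = 0 := by
  intro t mono hmono ψ hX hZ hψ
  -- the monomials as products of Pauli strings (the Jordan–Wigner words of the excited blocks)
  have hW : ∀ s, mono s = (((List.finRange t).filterMap fun b =>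
      (s b).map fun q => majoranaWord (t * 4) (finProdFinEquiv (b, q.1)) q.2).map pauliString).prod := by
    intro s
    rw [hmono, List.map_filterMap]
    simp only [Option.map_map]
    rfl
  -- unitarity of the monomials, hence the norms
  have hU : ∀ s, mono s ∈ Matrix.unitaryGroup (QReg (t * 4)) ℂ := by
    intro s
    rw [hW]
    refine list_prod_mem fun x hx => ?_
    obtain ⟨S, -, rfl⟩ := List.mem_map.1 hx
    exact flatOrtho_pauliString_mem_unitaryGroup S
  refine ⟨fun s => by rw [flatOrtho_dot_mulVec_unitary (hU s), hψ], fun s s' hss' => ?_⟩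
  -- conjugation of a monomial by a string whose factor signs are trivial off the block `b₀`
  have hconj : ∀ (P : Fin (t * 4) → Pauli) (b₀ : Fin t) (σ₀ : Fin 4 × Bool → ℂ),
      (∀ (b : Fin t) (i : Fin 4) (β : Bool),
        ∏ w, Pauli.sign (P w) (majoranaWord (t * 4) (finProdFinEquiv (b, i)) β w) =
          if b = b₀ then σ₀ (i, β) else 1) →
      ∀ s, pauliString P * mono s * pauliString P = ((s b₀).map σ₀).getD 1 • mono s := by
    intro P b₀ σ₀ hσ s
    rw [hW s, flatOrtho_conj_listProd, flatOrtho_prod_map_filterMap, Finset.prod_eq_single b₀]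
    · congr 1
      cases s b₀ with
      | none => rfl
      | some q => simpa using hσ b₀ q.1 q.2
    · intro b _ hb
      cases s b with
      | none => rfl
      | some q =>
        simp only [Option.map_some, Option.getD_some]
        rw [hσ, if_neg hb]
    · exact fun h => absurd (Finset.mem_univ _) h
  have hXc : ∀ (b₀ : Fin t) (s : Fin t → Option (Fin 4 × Bool)),
      pauliString (fun w : Fin (t * 4) =>
          if (finProdFinEquiv.symm w).1 = b₀ then Pauli.X else Pauli.I) * mono s *
        pauliString (fun w : Fin (t * 4) =>
          if (finProdFinEquiv.symm w).1 = b₀ then Pauli.X else Pauli.I) =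
        ((s b₀).map fun q => (-1 : ℂ) ^ ((q.1 : ℕ) + q.2.toNat)).getD 1 • mono s :=
    fun b₀ => hconj _ b₀ (fun q => (-1 : ℂ) ^ ((q.1 : ℕ) + q.2.toNat))
      (fun b i β => flatOrtho_sign_X b₀ b i β)
  have hZc : ∀ (b₀ : Fin t) (i₁ i₂ : Fin 4), i₁ ≠ i₂ → ∀ s : Fin t → Option (Fin 4 × Bool),
      pauliString (fun w : Fin (t * 4) =>
          if w = finProdFinEquiv (b₀, i₁) ∨ w = finProdFinEquiv (b₀, i₂) then Pauli.Z else Pauli.I) *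
        mono s * pauliString (fun w : Fin (t * 4) =>
          if w = finProdFinEquiv (b₀, i₁) ∨ w = finProdFinEquiv (b₀, i₂) then Pauli.Z else Pauli.I) =
        ((s b₀).map fun q => if q.1 = i₁ ∨ q.1 = i₂ then (-1 : ℂ) else 1).getD 1 • mono s :=
    fun b₀ i₁ i₂ h12 => hconj _ b₀ (fun q => if q.1 = i₁ ∨ q.1 = i₂ then (-1 : ℂ) else 1)
      (fun b i β => flatOrtho_sign_Z b₀ h12 b i β)
  have hPu : ∀ S : Fin (t * 4) → Pauli, pauliString S ∈ Matrix.unitaryGroup (QReg (t * 4)) ℂ :=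
    flatOrtho_pauliString_mem_unitaryGroup
  have h3 : ∀ a c : Fin 4, ∃ d, d ≠ a ∧ d ≠ c := by decide
  -- a block where the two patterns differ, and the case analysis
  obtain ⟨b₀, hb₀⟩ := Function.ne_iff.1 hss'
  rcases hs : s b₀ with _ | ⟨i, β⟩ <;> rcases hs' : s' b₀ with _ | ⟨i', β'⟩
  · exact absurd (hs.trans hs'.symm) hb₀
  · -- `s` silent, `s'` excites wire `i'` of `b₀`: the pair `Z_{i'} Z_d`
    obtain ⟨d, hd, -⟩ := h3 i' i'
    refine flatOrtho_inner_eq_zero (hPu _) (hZ b₀ i' d hd.symm) (hZc b₀ i' d hd.symm s)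
      (hZc b₀ i' d hd.symm s') ?_
    rw [hs, hs']
    simp
  · -- `s` excites wire `i` of `b₀`, `s'` silent: the pair `Z_i Z_d`
    obtain ⟨d, hd, -⟩ := h3 i i
    refine flatOrtho_inner_eq_zero (hPu _) (hZ b₀ i d hd.symm) (hZc b₀ i d hd.symm s)
      (hZc b₀ i d hd.symm s') ?_
    rw [hs, hs']
    simp
  · by_cases hii : i = i'
    · -- same wire, `X` vs `Y`: the block string `X⊗4`
      subst hii
      have hββ : β ≠ β' := fun h => hb₀ (by rw [hs, hs', h])
      refine flatOrtho_inner_eq_zero (hPu _) (hX b₀) (hXc b₀ s) (hXc b₀ s') ?_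
      rw [hs, hs']
      simp only [Option.map_some, Option.getD_some]
      rw [star_pow, star_neg, star_one, ← pow_add]
      have hsum : β.toNat + β'.toNat = 1 := by
        cases β <;> cases β' <;> first | rfl | exact absurd rfl hββ
      have : (i : ℕ) + β.toNat + ((i : ℕ) + β'.toNat) = 2 * i + 1 := by omega
      rw [this, pow_succ, pow_mul, neg_one_sq, one_pow, one_mul]
    · -- different wires `i ≠ i'` of `b₀`: the pair `Z_i Z_d` with `d ∉ {i, i'}`
      obtain ⟨d, hd, hd'⟩ := h3 i i'
      refine flatOrtho_inner_eq_zero (hPu _) (hZ b₀ i d hd.symm) (hZc b₀ i d hd.symm s)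
        (hZc b₀ i d hd.symm s') ?_
      rw [hs, hs']
      simp [Ne.symm hii, Ne.symm hd']

end Summit.QuantumAdvantage.QuantumAdvantage.Theorems.SpinorFlattening

end
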